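import Literature.MathematicalPhysics.QuantumFieldTheory.Balaban1983to89.B16Improved189ArbitraryRegionFull

/-!
# `Balaban1983to89.B16Cor3FactorLeavesOfFullBudget` — [Balaban1989LargeFieldII] p. 387 ll. 21–27 read into the Cor.-3 chain
WITH THE PRINTED BUDGET: the chain's two torus END theorems — `B16Cor3CurlyGas.uvIneq_of_repr172_torus_of_ineq249_of_gas`
(`𝐓″1` reading, leaves `hZ`∕`hY`) and `B16Cor3Torus.uvIneq_of_repr172_wilson_torus` (Wilson reading, leaves `hw`∕`hY`) —
with the leaves SUPPLIED from (1.80)∕(1.80)⁺ budget data by `B16Improved189ArbitraryRegionFull` and ONE constant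
`c 0 = c 1 = c₀` (print: `c₀ = 2(1+β₀)⁻¹p₀(g_k)`), so that the entropy term reads `M⁻⁴·K₀(64,8)·2e^{−c₀}`

T. Bałaban, *Large field renormalization. II. Localization, exponentiation, and bounds for the 𝐑 operation*, Commun.
Math. Phys. **122** (1989) 355–392, doi:10.1007/bf01238433 [Balaban1989LargeFieldII]; [III] = [Balaban1988Convergent] Cor. 3
(2.49)–(2.50) p. 264.

statement-level bookkeeping of a published proof with citation tags; proofs kernel-checked; nothing here is a claim
about the Yang–Mills mass gap

CITATION HEADER.  p. 387 [PDF 33] ll. 21–27 (text layer): *"… the fundamental inequality 𝐓′_k(X)1 ≦ exp(−2(1+β₀)⁻¹p₀(g_k)).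
(1.89) … hence also an improved bound (1.89), with the additional term −κ₁d_k(X) in the exponential. This implies the
inequality (2.50) [III], hence Corollary 3."*

WHY THIS FILE.  `B16Cor3FactorLeavesOfBudget` (n13-d) issued both END theorems with the leaves supplied at HALF the budget
(`c 0 = c 1 = ap`, `a = (1+β₀)⁻¹`, `p = p₀(g_k)`, entropy `2e^{−ap}`).  `B16Improved189ArbitraryRegionFull` (this seat, p585233)
delivers the leaves with the FULL budget (`hZ_full_of_budget_torus`, `hw_full_of_budget_torus`, `hY_full_of_controlsT_torus`;
`c₀ ≤ P` per component, slope clause doubled, no deficit clause, the `Y_i` from (1.80)⁺ at the horizon).  THIS FILE is the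
by-name junction: the two END theorems with those leaves plugged in, every other binder and the conclusion VERBATIM —
CONDITIONAL on every input, nothing of Bałaban's asserted; it shows the printed constant reaches (0.1)∕(2.50)'s `E₊`.

WHAT THIS FILE PROVES (kernel-checked, zero `sorry`, two theorems, no `def`; axioms standard; BY NAME over the two END theorems
and the three full-budget leaves): **`uvIneq_of_repr172_torus_of_fullBudget_of_gas`**, **`uvIneq_of_repr172_wilson_torus_of_fullBudget`**.
HONEST SCOPE.  As `B16Cor3FactorLeavesOfBudget`: by-name junction, count-neutral, NOT a discharge of N13; the per-component
inputs (factor forms, (1.80) with `K ≥ 1`, (1.80)⁺ at `K = 0`, lifts, `c₀ ≤ P`), the (1.90) gas, the cube count, (2.49) with its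
log-term bounds, `hsplit`∕`hpull` stay hypotheses exactly as print states them; dimension 4; which budget (2.50) needs is
unprinted (GAPS G-adv3-2) — this file shows the PRINTED one propagates; one finite 𝕋⁴ programme at fixed ε, Bałaban AS
PRINTED; R4 closes the conditional finite-𝕋⁴ rung `BalabanLadder.UV` only — nothing continuum ∕ OS ∕ mass gap ∕ Clay.  Seat
`pub-ymgap-dag-n13-w2` (g0), N13 [B16] Cor. 3, W-SEAT-START-LIST §1 n13 item 2, `--supports stmt-QuantumFields-20542`.
-/

noncomputable section

namespace Literature.MathematicalPhysics.QuantumFieldTheory.Balaban1983to89.B16Cor3FactorLeavesOfFullBudget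

open Literature.MathematicalPhysics.QuantumFieldTheory.Balaban1983to89
open Literature.MathematicalPhysics.QuantumFieldTheory.Balaban1983to89.B13ScaleTransfer (Pt FaceConnected)
open Literature.MathematicalPhysics.QuantumFieldTheory.Balaban1983to89.TreeLength (treeLen)
open Literature.MathematicalPhysics.QuantumFieldTheory.Balaban1983to89.B16SProfile (Sop)
open Literature.MathematicalPhysics.QuantumFieldTheory.Balaban1983to89.B13Factor210Literal (fineCubes)
open Literature.MathematicalPhysics.QuantumFieldTheory.Balaban1983to89.B16Improved189ArbitraryRegionFull
  (hZ_full_of_budget_torus hw_full_of_budget_torus hY_full_of_controlsT_torus)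
open Literature.MathematicalPhysics.QuantumFieldTheory.Balaban1983to89.TreeLengthTorus (tsys proj)
open Literature.MathematicalPhysics.QuantumFieldTheory.Balaban1983to89.B16Cor3Ops (PosOp Repr172)
open Literature.MathematicalPhysics.QuantumFieldTheory.Balaban1983to89.B16Cor3Wilson (Pull)
open Literature.MathematicalPhysics.QuantumFieldTheory.Balaban1983to89.B14Thm2 (Ineq249)
open Literature.MathematicalPhysics.QuantumFieldTheory.Balaban1983to89.B13FamilySum (Ineq126 VolBound)
open Literature.MathematicalPhysics.QuantumFieldTheory.Balaban1983to89.B16Eq190Resummation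
  (bracket mayerTerm F191 polys190 LocalOps DepOn)

/-- **(0.1) ∕ (2.50), ONE RUN, ONE STEP, ON THE TORUS — `𝐓″1` READING, FULL PRINTED BUDGET**:
`B16Cor3CurlyGas.uvIneq_of_repr172_torus_of_ineq249_of_gas` (dimension 4) with `hZ` supplied by
`hZ_full_of_budget_torus` (components of `Z_k`: lifts, horizons `K ≥ 1`, budgets with the (1.79)-factor form, (1.80), profiles
with `s_{k+1} = d′_{k+1}(S(X))`, `c₀ ≤ P`; dictionary `R_k·q = L·R_{k+1}`; doubled slope clause) and `hY` by
`hY_full_of_controlsT_torus` (domains `Y_i`: lifts, budgets with the factor form, (1.80)⁺ at `K = 0`, `c₀ ≤ PY`), constants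
`c 0 = c 1 = c₀`; every other input ((1.72) datum, χ-dictionary, the (1.90) gas, the cube count, (2.49) with the volume majorant
and the log-term bounds, the sign of `A`) and the conclusion VERBATIM as in `B16Cor3FactorLeavesOfBudget` §4, the entropy term
reading `M⁻⁴·K₀(64,8)·Σ_{i<2} e^{−c₀}`.  CONDITIONAL on every input. [cite: Balaban1989LargeFieldII, (0.1) p.356, p.387 ll.21–27, (1.80) p.384; Balaban1988Convergent, Cor. 3 (2.49)–(2.50) p.264] -/
theorem uvIneq_of_repr172_torus_of_fullBudget_of_gas (D : B16.RunData) (k : ℕ) (N : ℕ) [NeZero N]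
    (Rp : Repr172 (D.Cfg k) (tsys 4 N).Dom)
    {M : ℝ} (hM0 : M ≠ 0) (hnum : (D.numSites k : ℝ) = (M * N) ^ 4)
    {κ₁ : ℝ} (hκ : B12TreeDecay.kappa₀ (4 * 2 ^ 4) (2 * 4) ≤ κ₁) (hκ₁ : 0 ≤ κ₁) (c₀ : ℝ)
    (hH : Rp.Holds (D.ρ k))
    (hχ01 : ∀ t V, 0 ≤ Rp.χ t V ∧ Rp.χ t V ≤ 1)
    (h0χ : ∀ V, Rp.χ Rp.allSmall V = D.χ k V)
    -- the components of `Z_k`: composite structure and per-component (1.79)/(1.80) data, replacing `hZ`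
    (T : Rp.Adm → (tsys 4 N).Dom → PosOp (D.Cfg k)) (l : Rp.Adm → List (tsys 4 N).Dom)
    (hnd : ∀ t, (l t).Nodup) (hset : ∀ t, (l t).toFinset = Rp.Zc t)
    (hTZ : ∀ t F V, (Rp.TZ t).T F V = (PosOp.pi (T t) (l t)).T F V)
    (b : Step.Budget.Consts) (L : ℝ) {R q : ℕ} (hR : 0 < R) (hq : 0 < q)
    (hC : 0 ≤ b.C) (hbM : 0 ≤ b.M) (hRm : ∀ m, 0 ≤ b.R m) (hdim : b.d = 4)
    (hRq : ((R * q : ℕ) : ℝ) = L * b.R (k + 1)) (hL : 0 ≤ L)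
    (hslope2 : 2 * (κ₁ * (4 * 2 ^ 4) * L ^ b.d) ≤ b.C * b.M ^ b.d * b.R (k + 1))
    (X₀ : Rp.Adm → (tsys 4 N).Dom → Finset (Pt 4)) (K : Rp.Adm → (tsys 4 N).Dom → ℕ)
    (κ P : Rp.Adm → (tsys 4 N).Dom → ℝ) (s : Rp.Adm → (tsys 4 N).Dom → ℕ → ℝ)
    (hdataZ : ∀ t, ∀ X ∈ Rp.Zc t, (X₀ t X).Nonempty ∧ FaceConnected (X₀ t X) ∧
      X.1 = (fineCubes R (X₀ t X)).image (proj N) ∧ 1 ≤ K t X ∧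
      (∀ V, (T t X).T 1 V ≤ Real.exp (-(κ t X) - P t X)) ∧ Step.Budget.Controls b k (K t X) (κ t X) (s t X) ∧
      (∀ m, 0 ≤ s t X m) ∧ s t X (k + 1) = treeLen (Sop q (X₀ t X)) ∧ c₀ ≤ P t X)
    -- the domains `Y_i`: composite structure and per-domain (1.80)⁺ horizon-0 data, replacing `hY`
    (TY : Rp.Adm → (tsys 4 N).Dom → PosOp (D.Cfg k)) (lY : Rp.Adm → List (tsys 4 N).Dom)
    (hndY : ∀ t, (lY t).Nodup) (hsetY : ∀ t, (lY t).toFinset = Rp.Ys t)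
    (hTYs : ∀ t F V, (Rp.TYs t).T F V = (PosOp.pi (TY t) (lY t)).T F V)
    (SY : Rp.Adm → (tsys 4 N).Dom → Finset (Pt 4)) (κY PY : Rp.Adm → (tsys 4 N).Dom → ℝ)
    (sY : Rp.Adm → (tsys 4 N).Dom → ℕ → ℝ)
    (hdataY : ∀ t, ∀ Y ∈ Rp.Ys t, (SY t Y).Nonempty ∧ FaceConnected (SY t Y) ∧
      Y.1 = (fineCubes R (SY t Y)).image (proj N) ∧ (∀ V, (TY t Y).T 1 V ≤ Real.exp (-(κY t Y) - PY t Y)) ∧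
      Step.Budget.Controls b k 0 (κY t Y - κ₁ * treeLen (fineCubes R (SY t Y))) (sY t Y) ∧ c₀ ≤ PY t Y)
    -- the (1.90) gas of every admissible term (verbatim)
    {LF DomY Cube Var Sv : Type*} [Fintype LF] [Fintype DomY] [Fintype Cube] [DecidableEq LF] [DecidableEq DomY]
    [DecidableEq Cube] {adjC : Cube → Cube → Prop} [DecidableRel adjC]
    (hrefl : ∀ c, adjC c c) (hsymm : ∀ c c', adjC c c' → adjC c' c)
    {locX : LF → Finset Cube} {locY : DomY → Finset Cube} {site : Var → Cube} (Yfix : Rp.Adm → Finset Cube)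
    (houtX : ∀ t j, (locX j \ Yfix t).Nonempty) (houtY : ∀ t Y, (locY Y \ Yfix t).Nonempty)
    (Op : Rp.Adm → Finset LF → ((Var → Sv) → ℂ) →+ ((Var → Sv) → ℂ))
    (hOps : ∀ t, LocalOps adjC locX (Yfix t) site (Op t))
    (hOpReal : ∀ t (S : Finset LF) (f : (Var → Sv) → ℂ), (∀ ψ, (f ψ).im = 0) → ∀ φ, (Op t S f φ).im = 0)
    (Vt : Rp.Adm → DomY → (Var → Sv) → ℂ) (hV : ∀ t Y, DepOn (Yfix t) site (Vt t Y) (locY Y))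
    (hVreal : ∀ t Y ψ, (Vt t Y ψ).im = 0) (cfg : D.Cfg k → (Var → Sv))
    {nbr : Cube → Finset Cube} (hnbr : ∀ c c', adjC c c' → c ∈ nbr c') {ν : ℝ} (hν : ∀ c, ((nbr c).card : ℝ) ≤ ν)
    {d : Rp.Adm → Finset Cube → ℝ} {c₁ Rr κ₀ K₀ cv τ : ℝ} (hd : ∀ t X, 0 ≤ d t X) (hc₁ : 0 ≤ c₁) (hK₀ : 0 ≤ K₀)
    (hτ : 0 ≤ τ)
    (h197 : ∀ t V X, ‖F191 adjC locX locY (Yfix t) (mayerTerm (Op t) (Vt t) (cfg V)) X‖ ≤ c₁ * Real.exp (-(Rr * d t X)))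
    (h126 : ∀ t, Ineq126 (polys190 adjC locX locY (Yfix t)) (fun X => X \ Yfix t) (d t) κ₀ K₀)
    (hvol : ∀ t, VolBound (polys190 adjC locX locY (Yfix t)) (fun X => X \ Yfix t) (d t) cv)
    (hrate : κ₀ + τ * cv ≤ Rr) (hsmall : c₁ * Real.exp (τ * cv) * K₀ * ν ≤ τ)
    (hjunction : ∀ t V, Rp.curly t V = (bracket (Op t) (Vt t) (cfg V)).re)
    {πc : ℝ} (hQ : (Fintype.card Cube : ℝ) ≤ πc * (D.numSites k : ℝ))
    -- (2.49) for `A′` and its logarithmic terms (verbatim)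
    (logT : D.Cfg k → ℝ) {CA cΓ cL cL' : ℝ} {Γ : ℕ → ℝ} (hCA : 0 ≤ CA)
    (hΓ : ∑ m ∈ Finset.Icc 1 k, Γ m ≤ cΓ * (D.numSites k : ℝ))
    (h249 : ∀ V, Ineq249 (Rp.A' V) (1 / (D.flow.g k) ^ 2 * D.wilsonBG k V) (logT V) CA Γ k)
    (hlog : ∀ V, -(cL * (D.numSites k : ℝ)) ≤ logT V) (hlog' : ∀ V, logT V ≤ cL' * (D.numSites k : ℝ))
    (hA0 : ∀ V, 0 ≤ D.wilsonBG k V) :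
    ∀ V : D.Cfg k, B16.UVIneq D k V (CA * cΓ + cL + πc * (c₁ * Real.exp (τ * cv) * K₀))
      (CA * cΓ + cL' + πc * (c₁ * Real.exp (τ * cv) * K₀) +
        M⁻¹ ^ 4 * B12TreeDecay.K₀ (4 * 2 ^ 4) (2 * 4) * ∑ _i : Fin 2, Real.exp (-c₀)) :=
  B16Cor3CurlyGas.uvIneq_of_repr172_torus_of_ineq249_of_gas D k N Rp hM0 hnum hκ (fun _ => c₀) hH hχ01 h0χ
    (hZ_full_of_budget_torus Rp T l hnd hset hTZ b k c₀ κ₁ L hR hq (by norm_num) hC hbM hRm hdim hRq hκ₁ hL hslope2 X₀ K κ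
      P s hdataZ)
    (hY_full_of_controlsT_torus Rp TY lY hndY hsetY hTYs b k c₀ κ₁ hR hκ₁ SY κY PY sY hdataY)
    hrefl hsymm Yfix houtX houtY Op hOps hOpReal Vt hV hVreal cfg hnbr hν hd hc₁ hK₀ hτ h197 h126 hvol hrate hsmall
    hjunction hQ logT hCA hΓ h249 hlog hlog' hA0

/-- **(0.1) ∕ (2.50), ONE RUN, ONE STEP, WILSON FORM ON THE TORUS — FULL PRINTED BUDGET**:
`B16Cor3Torus.uvIneq_of_repr172_wilson_torus` with `hw` supplied by `hw_full_of_budget_torus` (components of `Z_k`, `K ≥ 1`,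
plain (1.80)) and `hY` by `hY_full_of_controlsT_torus` (domains `Y_i`, `K = 0`, (1.80)⁺), `c 0 = c 1 = c₀`; every other input
(component structure `hTZ`, pull-out law `hpull`, Boltzmann factors `B` with the split `hsplit`, curly bracket, (2.49) lower
bookkeeping) and the conclusion VERBATIM as in `B16Cor3FactorLeavesOfBudget` §5, entropy term `M⁻⁴·K₀(64,8)·Σ_{i<2} e^{−c₀}`.
CONDITIONAL on every input. [cite: Balaban1989LargeFieldII, (0.1) p.356, p.380 after (1.73), p.387 ll.21–27; Balaban1988Convergent, Cor. 3 (2.50) p.264] -/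
theorem uvIneq_of_repr172_wilson_torus_of_fullBudget (D : B16.RunData) (k : ℕ) (N : ℕ) [NeZero N]
    (Rp : Repr172 (D.Cfg k) (tsys 4 N).Dom)
    {M : ℝ} (hM0 : M ≠ 0) (hnum : (D.numSites k : ℝ) = (M * N) ^ 4)
    {κ₁ : ℝ} (hκ : B12TreeDecay.kappa₀ (4 * 2 ^ 4) (2 * 4) ≤ κ₁) (hκ₁ : 0 ≤ κ₁) (c₀ : ℝ)
    (Rre : D.Cfg k → ℝ) (E₁ ε ε' E' : ℝ)
    (hH : Rp.Holds (D.ρ k))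
    (hχ01 : ∀ t V, 0 ≤ Rp.χ t V ∧ Rp.χ t V ≤ 1)
    (h0χ : ∀ V, Rp.χ Rp.allSmall V = D.χ k V)
    (T : Rp.Adm → (tsys 4 N).Dom → PosOp (D.Cfg k)) (l : Rp.Adm → List (tsys 4 N).Dom)
    (hnd : ∀ t, (l t).Nodup) (hset : ∀ t, (l t).toFinset = Rp.Zc t)
    (hTZ : ∀ t F V, (Rp.TZ t).T F V = (PosOp.pi (T t) (l t)).T F V)
    (B : Rp.Adm → (tsys 4 N).Dom → D.Cfg k → ℝ)
    (hB : ∀ t, ∀ X ∈ Rp.Zc t, ∀ V, 0 ≤ B t X V)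
    (hpull : ∀ t, ∀ X ∈ Rp.Zc t, ∀ X' ∈ Rp.Zc t, X ≠ X' → Pull (T t X) (B t X'))
    -- per-component (1.80) budget data replacing `hw` (full budget)
    (b : Step.Budget.Consts) (L : ℝ) {R q : ℕ} (hR : 0 < R) (hq : 0 < q)
    (hC : 0 ≤ b.C) (hbM : 0 ≤ b.M) (hRm : ∀ m, 0 ≤ b.R m) (hdim : b.d = 4)
    (hRq : ((R * q : ℕ) : ℝ) = L * b.R (k + 1)) (hL : 0 ≤ L)
    (hslope2 : 2 * (κ₁ * (4 * 2 ^ 4) * L ^ b.d) ≤ b.C * b.M ^ b.d * b.R (k + 1))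
    (X₀ : Rp.Adm → (tsys 4 N).Dom → Finset (Pt 4)) (K : Rp.Adm → (tsys 4 N).Dom → ℕ)
    (κ P : Rp.Adm → (tsys 4 N).Dom → ℝ) (s : Rp.Adm → (tsys 4 N).Dom → ℕ → ℝ)
    (hdataZ : ∀ t, ∀ X ∈ Rp.Zc t, (X₀ t X).Nonempty ∧ FaceConnected (X₀ t X) ∧
      X.1 = (fineCubes R (X₀ t X)).image (proj N) ∧ 1 ≤ K t X ∧
      (∀ V, (T t X).T (B t X) V ≤ Real.exp (-(κ t X) - P t X)) ∧ Step.Budget.Controls b k (K t X) (κ t X) (s t X) ∧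
      (∀ m, 0 ≤ s t X m) ∧ s t X (k + 1) = treeLen (Sop q (X₀ t X)) ∧ c₀ ≤ P t X)
    (hsplit : ∀ t V, Real.exp (Rp.A' V) ≤ Real.exp (E' * (D.numSites k : ℝ)) * ∏ X ∈ Rp.Zc t, B t X V)
    -- per-domain (1.80)⁺ horizon-0 data replacing `hY`
    (TY : Rp.Adm → (tsys 4 N).Dom → PosOp (D.Cfg k)) (lY : Rp.Adm → List (tsys 4 N).Dom)
    (hndY : ∀ t, (lY t).Nodup) (hsetY : ∀ t, (lY t).toFinset = Rp.Ys t)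
    (hTYs : ∀ t F V, (Rp.TYs t).T F V = (PosOp.pi (TY t) (lY t)).T F V)
    (SY : Rp.Adm → (tsys 4 N).Dom → Finset (Pt 4)) (κY PY : Rp.Adm → (tsys 4 N).Dom → ℝ)
    (sY : Rp.Adm → (tsys 4 N).Dom → ℕ → ℝ)
    (hdataY : ∀ t, ∀ Y ∈ Rp.Ys t, (SY t Y).Nonempty ∧ FaceConnected (SY t Y) ∧
      Y.1 = (fineCubes R (SY t Y)).image (proj N) ∧ (∀ V, (TY t Y).T 1 V ≤ Real.exp (-(κY t Y) - PY t Y)) ∧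
      Step.Budget.Controls b k 0 (κY t Y - κ₁ * treeLen (fineCubes R (SY t Y))) (sY t Y) ∧ c₀ ≤ PY t Y)
    (hcurly : ∀ t V, 0 ≤ Rp.curly t V ∧ Rp.curly t V ≤ Real.exp (ε' * (D.numSites k : ℝ)))
    (h0c : ∀ V, Rp.curly Rp.allSmall V = Real.exp (Rre V))
    (hRre : ∀ V, |Rre V| ≤ ε * (D.numSites k : ℝ))
    (hA' : ∀ V, D.χ k V ≠ 0 →
      -(1 / (D.flow.g k) ^ 2 * D.wilsonBG k V) - E₁ * (D.numSites k : ℝ) ≤ Rp.A' V) :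
    ∀ V : D.Cfg k, B16.UVIneq D k V (E₁ + ε)
      (E' + ε' + M⁻¹ ^ 4 * B12TreeDecay.K₀ (4 * 2 ^ 4) (2 * 4) * ∑ _i : Fin 2, Real.exp (-c₀)) :=
  B16Cor3Torus.uvIneq_of_repr172_wilson_torus D k N Rp hM0 hnum hκ (fun _ => c₀) Rre E₁ ε ε' E' hH hχ01 h0χ T l hnd
    hset hTZ B hB hpull
    (hw_full_of_budget_torus Rp T B b k c₀ κ₁ L hR hq (by norm_num) hC hbM hRm hdim hRq hκ₁ hL hslope2 X₀ K κ P s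
      hdataZ)
    hsplit (hY_full_of_controlsT_torus Rp TY lY hndY hsetY hTYs b k c₀ κ₁ hR hκ₁ SY κY PY sY hdataY) hcurly h0c hRre
    hA'

end Literature.MathematicalPhysics.QuantumFieldTheory.Balaban1983to89.B16Cor3FactorLeavesOfFullBudget

end
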